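import Literature.AlgebraicGeometry.HodgeTheory.AtiyahClassTraceReal
import Literature.AlgebraicGeometry.HodgeTheory.ChernCharacterBetti
import Literature.AlgebraicGeometry.HodgeTheory.DirectImageTransport
import Literature.AlgebraicGeometry.HodgeTheory.GlobalInvariantCycles
import Literature.AlgebraicGeometry.HodgeTheory.LefschetzOneOne
import Literature.AlgebraicGeometry.KTheory.PullbackVectorBundle
import Literature.AlgebraicGeometry.Motives.FamiliesVHS
import HarnessLib

/-!
# The variational Hodge conjecture for the Chern character of a semiregular sheaf
# (Buchweitz–Flenner 2003, Thm. 5.1, `I = {1, 2}`; Perry 2026, Thm. 1.1 (2), global form)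

Family `hodge`, layer `Literature/AlgebraicGeometry/HodgeTheory`. NAMED FACT (D-0014) requested by the
crux-plan of `stmt-HodgeConjecture-14522` (`defn-PolarisedK3TwinKuranishiFamily`, item (3): "Buchweitz–
Flenner 2003 Thm 5.1 as a NAMED FACT over these carriers: smooth proper deformation over a smooth germ,
`E₀` `{0,1}`-semiregular (tree `IsZeroOneSemiregular`) on the projective central fibre, flat transports
of `ch₁`, `ch₂` (in a `ChernCharacterBetti` `C`) of type `(1,1)`, `(2,2)` on all fibres ⇒ the transport
of `ch₂` lies in `algebraicClasses` of every nearby fibre") for the stub `SemiregularTwinVHC` of the line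
`Cruxes/TwinTwistorTransport/Lines/semiregular-twin-hodge-locus.lean`. The module docstring of
`SemiregularityMap.lean` announced this fact "in its own file once relative families have carriers";
the carriers are now `Motives.IsSmoothProjectiveFamily`, `IsCohomologicallyLocallyTrivialOn` and
`transportFun` (`HodgeTheory/DirectImageCovering`, `DirectImageTransport`; Ehresmann is the tree's PROVED
`isCohomologicallyLocallyTrivialOn_univ_of_isSmoothProjectiveFamily`) and, for global flat sections,
`FiberClass` / `locusOfHodgeClasses` (`HodgeTheory/HodgeLocus`). Two named facts: the printed GERM form
(BF Thm. 5.1, partial Chern character `I = {1,2}`) and the printed GLOBAL form (Perry Thm. 1.1 (2), full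
Chern character over a complex variety `S`) — the latter also serves STUB 2 `SemiregularVariationalHodge`
of the parallel line `Cruxes/HodgeSimilitudeAlgebraic/Lines/semiregular-twin-hecke-vhc.lean`.

## Source, verbatim (held text `paper:arxiv-math_9912245` = Compositio Math. 137 (2003), §5, read 2026-08-16)

§5 (p. 25 of the arXiv text): "Let `X` be a compact complex algebraic manifold […] a cohomology class
`α ∈ H^{p,p}(X, ℚ) := H^p(X, Ω^p_X) ∩ H^{2p}(X, ℚ)` is called algebraic if an appropriate multiple
`kα`, `k ∈ ℕ`, is represented by an algebraic cycle […] Let `π : X → S` be a deformation of a compact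
algebraic manifold `X_0 = π⁻¹(0)` over a smooth germ `(S, 0)`. The local system `R^{2p}f_*(ℂ) ⊗ 𝒪_S`
carries then the natural Gauß–Manin connection. Assume that `α` is a horizontal section of
`R^p f_*(Ω^p_{X/S})` in the sense that `α` can be lifted locally to a horizontal section in
`R^{2p}f_*(Ω^{≥p}_{X/S}) ⊆ R^{2p}f_*(ℂ) ⊗ 𝒪_S` […] `ℰ_0` is called `I`-semiregular if the part of the
semiregularity map `σ_I : Ext²_{X_0}(ℰ_0, ℰ_0) → ∏_{p ∈ I} H^{p+1}(X_0, Ω^{p-1}_{X_0})` is injective.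
**Theorem 5.1.** Let `π : X → S` be a deformation of a compact complex algebraic manifold `X_0` over a
smooth germ `S = (S, 0)` and set `X_s := π⁻¹(s)` for `s ∈ S`. Assume that `(α_p)_{p ∈ I}` is a horizontal
section in `∏_{p ∈ I} R^p π_*(Ω^p_{X/S})`. If there is an `I`-semiregular sheaf `ℰ_0` on `X_0` with
`α_p(0) = ch_p(ℰ_0) ∈ H^p(X_0, Ω^p_{X_0})`, `p ∈ I`, then `α_p(s) ∈ H^p(X_s, Ω^p_{X_s})` is algebraic for
all `s ∈ S` near `0` and each `p ∈ I`." Proof (p. 27): `ℰ_0` lifts to all infinitesimal neighbourhoods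
(Prop. 5.9, Lemma 5.10), a versal deformation and "Artin's approximation theorem" give a coherent
`S`-flat `ℱ` on `X` inducing `ℰ_0`, and "the uniqueness of the horizontal lifting gives that
`α_p = ch_p(ℱ)` […] Hence `α_p(s) = ch_p(ℱ|X_s)` is algebraic for all `s ∈ S` near `0`".

Perry (arXiv:2604.00511, April 2026, UNREFEREED — tagged `[claim …]`; held text `paper:arxiv-2604.00511`,
read 2026-08-16), **Thm. 1.1**: "Let `f : X → S` be a smooth proper family of complex varieties. Let
`0 ∈ S(ℂ)` be a point and let `E_0 ∈ D_perf(X_0)` be a semiregular perfect complex with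
`Ext^{<0}(E_0, E_0) = 0`. Assume that `B_0 ∈ H²(X_0, ℚ(1))` is an algebraic class such that
`w_0 = exp(B_0) · ch(E_0) ∈ ⊕_{k ≥ 0} H^{2k}(X_0, ℚ(k))` remains Hodge along `S`, i.e. lifts to a
global section `w` of the local system `⊕_{k ≥ 0} R^{2k}f_*ℚ(k)`. Then: (1) […] `E_0` deforms as a
twisted perfect complex over an étale neighborhood of `0` […] (2) The class `w_0` remains algebraic
along `S`, i.e. for every point `s ∈ S(ℂ)` the fiber `w_s ∈ ⊕_{k ≥ 0} H^{2k}(X_s, ℚ(k))` of `w` over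
`s` is algebraic." It is the case `𝒞 = D_perf(X)` of Thm. 6.1, where "`S` is a complex variety"
(§1.3: "geometrically integral, separated, and finite type"), proved from Pridham's semiregularity
and [IHC-CY2]; Def. 2.4: "`E` is semiregular if `σ²_E : Ext²(E, E) → HH_{-2}(𝒞)` is injective",
Rem. 2.5: for `D_perf(X)` this "can be identified (after applying an HKR isomorphism) with the
semiregularity map of Buchweitz and Flenner" — so injectivity of the PART `(σ_0, σ_1)`
(`IsZeroOneSemiregular`) implies semiregularity.

## Rendering (the special case with carriers in the tree; hypotheses complete)

* The deformation: an ALGEBRAIC smooth projective family `π : 𝒳 ⟶ S` of relative dimension `n` over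
  `ℂ` (`Motives.IsSmoothProjectiveFamily π n`: smooth of relative dimension `n`, proper, all fibres
  smooth projective) over a SMOOTH base (`AlgebraicGeometry.Smooth S.hom` — "smooth germ"), a
  cohomologically locally trivial open `U ⊆ S(ℂ)` (`IsCohomologicallyLocallyTrivialOn π U`, the
  conclusion of Ehresmann's theorem, giving the transport `transportFun` of `R^k π_* ℂ|_U`) and a base
  point `s₀ ∈ U`; its analytification over a small ball around `s₀` is a deformation of the compact
  algebraic manifold `X_{s₀}(ℂ)` over a smooth germ, and all fibres `X_t` are projective, so "algebraic
  class on `X_t`" is the tree's `algebraicClasses (fiberOver π t) p` (`ℂ`-span of cycle classes ⊇ the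
  printed `ℚ`-multiples).
* `I = {1, 2}`: the printed `σ_{{1,2}} = (σ_0, σ_1) : Ext² → H²(X_0, 𝒪) × H³(X_0, Ω¹)` in the tree's
  numbering by FORM degree is `IsZeroOneSemiregular` (`AtiyahClassTraceReal.lean`: Mathlib's `Ext` in
  `X.Modules`, the tree's REAL Atiyah class and traces) of a finite locally free `ℰ_0`
  (`Motives.IsFiniteLocallyFree`; the paper allows coherent `ℰ_0`).
* "`(α_p)_{p ∈ I}` horizontal with `α_p(0) = ch_p(ℰ_0)`" ⟸ the flat transports `γ_* ch_p(ℰ_0)`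
  (`p = 1, 2`) along every path `γ` in `U` from `s₀` are of Hodge type `(p, p)` on the fibre reached
  (`IsOfHodgeType`): over a ball this is a horizontal section of `R^{2p}π_*ℂ` lying in `F^p`
  (indeed in `H^{p,p}`) at every point, i.e. a horizontal lift of its image in `R^pπ_*Ω^p`. The Chern
  character is taken in a Chern character theory `C : ChernCharacterBetti` on `H^{2•}(–(ℂ); ℂ)`
  (hypothesis structure; intended instance the topological Chern character, which agrees with the
  paper's Atiyah-class `ch_p` in `H^p(X_0, Ω^p) ⊂ H^{2p}(X_0, ℂ)` up to the universal non-zero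
  normalisation of degree `p`, immaterial for horizontality, Hodge type and algebraicity).
* Conclusion "algebraic for all `s` near `0`": there is an open `W`, `s₀ ∈ W ⊆ U` (a ball in the
  proof), such that for every `t ∈ W` and every path `γ` from `s₀` to `t` INSIDE `W` the transports of
  `ch_1(ℰ_0)`, `ch_2(ℰ_0)` (computed in `R^kπ_*ℂ|_W`) are algebraic on `X_t`.
* Perry's global form (`Perry2026_semiregular_remainsAlgebraic`): `S` a SMOOTH complex variety
  (`IsQuasiProjectiveOver S`, `IsIntegral S.left`, `Smooth S.hom` — smoothness is an extra hypothesis of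
  the rendering), `B_0 = 0`, `E_0` finite locally free (so `Ext^{<0} = 0`) and `{0,1}`-semiregular; "a
  global section `w` of `⊕_k R^{2k}f_*ℚ(k)` lifting `ch(E_0)`" is a family of CONTINUOUS sections
  `s ↦ (s, w_k(s))` of the étalé spaces `FiberClass π (2k)` (all `k ≥ 0`), with values rational and of
  type `(k,k)` (`locusOfHodgeClasses`; "remains Hodge") and `w_k(s₀) = ch_k(E_0)` in `C`; conclusion:
  `w_k(s) ∈ algebraicClasses (X_s) k` for every `s ∈ S(ℂ)` and every `k` (the Tate twists `ℚ(k)` are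
  degreewise non-zero scalars, immaterial).

## What is PROVED here (the last step of the printed proof of Thm. 5.1)

BF's proof (p. 27): infinitesimal liftings of `ℰ_0` (Prop. 5.9, Lemma 5.10), a versal deformation
and "Artin's approximation theorem" produce a coherent `S`-flat `ℱ` near `X_0` inducing `ℰ_0`; then
"the uniqueness of the horizontal lifting gives that `α_p = ch_p(ℱ)` […] Hence
`α_p(s) = ch_p(ℱ|X_s)` is algebraic". The final sentence is formalised on the tree's carriers for an
extension `ℱ` that is finite locally free on the total space `𝒳`:
`transportFun_ch_eq_ch_pullback_of_iso` (`γ_* ch_p(ℱ|X_s) = ch_p(ℱ|X_t)`: restrictions of the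
global class `ch_p(ℱ)` are flat, `transportFun_map_fiberι`, and `ch` commutes with pull-back),
`transportFun_ch_mem_algebraicClasses_of_iso` (hence algebraic on the smooth projective `X_t`) and
`BuchweitzFlenner2003_variationalHodge_semiregular.conclusion_of_iso_pullback` (the conclusion of
the fact, with `W = U`, whenever `ℰ_0 ≅ ℱ|X_{s₀}`). The `ch₁`-half of the conclusion is, granted
the rational Lefschetz `(1,1)` theorem and rational descent of tube classes, free of deformation
theory (`….ch_one_of_lefschetzOneOne`). The EXISTENCE of the extension from `I`-semiregularity and
horizontality (BF §3 obstruction theory, §5 Prop. 5.9 / Lemma 5.10, versality, Artin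
approximation) — the content of Thm. 5.1 — is not formalised: the fact stays a named fact.

## What is NOT here

Thm. 5.1 for other `I` (needs `Ω^q`, `q ≥ 2`: `defn-HodgeSheavesOmega`), for coherent / perfect
`ℰ_0`, Thm. 5.2 (semiregular subspaces, Bloch), the pro-representability results of BF §6–7; Perry's
conclusion (1) (the twisted deformation of `E_0`), `B_0 ≠ 0`, perfect complexes, the equivariant
Thm. 1.2 / 6.3 and the categorical Thm. 6.1; singular bases `S`.

## References

* [BuchweitzFlenner2003] R.-O. Buchweitz, H. Flenner, A semiregularity map for modules and applications
  to deformations, Compositio Math. 137 (2003), 135–210 (arXiv:math/9912245), §5 Thm. 5.1 and its proof.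
* [Bloch1972Semiregularity] S. Bloch, Semi-regularity and de Rham cohomology, Invent. Math. 17 (1972)
  (the case `ℰ_0 = 𝒪_Z`, `Z` a semiregular local complete intersection; through BF Thm. 5.2).
* [Grothendieck1966deRham] A. Grothendieck, On the de Rham cohomology of algebraic varieties, Publ.
  Math. IHÉS 29 (1966), footnote 13 (the variational Hodge conjecture; cited through BF §5 "[Gro]").
* [Perry2026Semiregularity] A. Perry, The semiregularity theorem for equivariant noncommutative
  varieties, arXiv:2604.00511 (2026), Thm. 1.1 (2), Thm. 6.1, Def. 2.4, Rem. 2.5, §1.3.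
* [VoisinHodgeI2002] C. Voisin, Hodge Theory and Complex Algebraic Geometry I, §9.2.1 (`R^kπ_*A`).
-/

noncomputable section

open CategoryTheory AlgebraicGeometry
open _root_.Topology _root_.Filter
open Literature.AlgebraicTopology.SingularHomology

namespace Literature.AlgebraicGeometry.HodgeTheory

section HodgeTheory

/-- **Buchweitz–Flenner 2003, Thm. 5.1 (variational Hodge conjecture for the Chern character of a
semiregular sheaf), case `I = {1, 2}`.** Printed: "Let `π : X → S` be a deformation of a compact complex
algebraic manifold `X_0` over a smooth germ `S = (S, 0)` […] Assume that `(α_p)_{p ∈ I}` is a horizontal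
section in `∏_{p∈I} R^pπ_*(Ω^p_{X/S})`. If there is an `I`-semiregular sheaf `ℰ_0` on `X_0` with
`α_p(0) = ch_p(ℰ_0)`, `p ∈ I`, then `α_p(s) ∈ H^p(X_s, Ω^p_{X_s})` is algebraic for all `s ∈ S` near `0`
and each `p ∈ I`." Rendering (module docstring): for every Chern character theory `C`, every smooth
projective family `π : 𝒳 ⟶ S` of relative dimension `n` over a smooth `ℂ`-scheme `S`, every
cohomologically locally trivial `U ⊆ S(ℂ)` with base point `s₀`, and every finite locally free
`{0,1}`-semiregular `ℰ_0` on `X_{s₀}` (`(σ_0, σ_1) = (Tr, Tr(At ∘ ·))` injective on `Ext²(ℰ_0, ℰ_0)`):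
if the transports of `ch_1(ℰ_0)` and `ch_2(ℰ_0)` along all paths in `U` are of type `(1,1)` and
`(2,2)` on the fibres reached, then on some open `W` with `s₀ ∈ W ⊆ U` the transports of `ch_1(ℰ_0)`,
`ch_2(ℰ_0)` along paths inside `W` are ALGEBRAIC classes of the fibres.
[cite: BuchweitzFlenner2003, §5 Thm. 5.1] -/
def BuchweitzFlenner2003_variationalHodge_semiregular : Prop :=
  ∀ (C : ChernCharacterBetti) ⦃𝒳 S : Motives.SchemeOver ℂ⦄ (π : 𝒳 ⟶ S) (n : ℕ),
    Motives.IsSmoothProjectiveFamily π n → _root_.AlgebraicGeometry.Smooth S.hom →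
    ∀ ⦃U : Set (Motives.ComplexPoints S)⦄ (hU : IsCohomologicallyLocallyTrivialOn π U) (s₀ : U)
      (E₀ : (Motives.fiberOver π s₀.1).left.Modules) (hE₀ : Motives.IsFiniteLocallyFree E₀),
      IsZeroOneSemiregular hE₀ →
      (∀ (t : U) (γ : Path.Homotopic.Quotient s₀ t),
          IsOfHodgeType n (Motives.fiberOver π t.1) (2 * 1) 1 1
              (transportFun π (2 * 1) hU γ (C.ch (Motives.fiberOver π s₀.1) E₀ 1)) ∧
            IsOfHodgeType n (Motives.fiberOver π t.1) (2 * 2) 2 2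
              (transportFun π (2 * 2) hU γ (C.ch (Motives.fiberOver π s₀.1) E₀ 2))) →
      ∃ (W : Set (Motives.ComplexPoints S)) (hWo : IsOpen W) (hW₀ : s₀.1 ∈ W) (hWU : W ⊆ U),
        ∀ (t : W) (γ : Path.Homotopic.Quotient (⟨s₀.1, hW₀⟩ : W) t),
          transportFun π (2 * 1) (hU.mono hWU hWo) γ (C.ch (Motives.fiberOver π s₀.1) E₀ 1) ∈
              algebraicClasses (Motives.fiberOver π t.1) 1 ∧
            transportFun π (2 * 2) (hU.mono hWU hWo) γ (C.ch (Motives.fiberOver π s₀.1) E₀ 2) ∈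
              algebraicClasses (Motives.fiberOver π t.1) 2

/-- **The `ch₂`-half of the conclusion in the form the route consumes**: under the fact, the flat
transport of `ch_2(ℰ_0)` is an algebraic class on every fibre over a neighbourhood `W` of `s₀` reached
by a path in `W`. [cite: BuchweitzFlenner2003, §5 Thm. 5.1] -/
theorem BuchweitzFlenner2003_variationalHodge_semiregular.ch_two_mem_algebraicClasses
    (hBF : BuchweitzFlenner2003_variationalHodge_semiregular) (C : ChernCharacterBetti)
    {𝒳 S : Motives.SchemeOver ℂ} (π : 𝒳 ⟶ S) (n : ℕ) (hπ : Motives.IsSmoothProjectiveFamily π n)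
    (hS : _root_.AlgebraicGeometry.Smooth S.hom) {U : Set (Motives.ComplexPoints S)}
    (hU : IsCohomologicallyLocallyTrivialOn π U) (s₀ : U) (E₀ : (Motives.fiberOver π s₀.1).left.Modules)
    (hE₀ : Motives.IsFiniteLocallyFree E₀) (hsr : IsZeroOneSemiregular hE₀)
    (hHodge : ∀ (t : U) (γ : Path.Homotopic.Quotient s₀ t),
      IsOfHodgeType n (Motives.fiberOver π t.1) (2 * 1) 1 1
          (transportFun π (2 * 1) hU γ (C.ch (Motives.fiberOver π s₀.1) E₀ 1)) ∧
        IsOfHodgeType n (Motives.fiberOver π t.1) (2 * 2) 2 2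
          (transportFun π (2 * 2) hU γ (C.ch (Motives.fiberOver π s₀.1) E₀ 2))) :
    ∃ (W : Set (Motives.ComplexPoints S)) (hWo : IsOpen W) (hW₀ : s₀.1 ∈ W) (hWU : W ⊆ U),
      ∀ (t : W) (γ : Path.Homotopic.Quotient (⟨s₀.1, hW₀⟩ : W) t),
        transportFun π (2 * 2) (hU.mono hWU hWo) γ (C.ch (Motives.fiberOver π s₀.1) E₀ 2) ∈
          algebraicClasses (Motives.fiberOver π t.1) 2 := by
  obtain ⟨W, hWo, hW₀, hWU, hW⟩ := hBF C π n hπ hS hU s₀ E₀ hE₀ hsr hHodge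
  exact ⟨W, hWo, hW₀, hWU, fun t γ => (hW t γ).2⟩

/-- **Sanity consequence at the base point**: the hypothesis already contains (at `t = s₀`, constant
path) that `ch_2(ℰ_0)` is of type `(2,2)` on `X_{s₀}`, and the fact then makes it algebraic there —
consistent with `ChernCharacterBetti.ch_mem_algebraicClasses` (Chern characters of algebraic vector
bundles on smooth projective varieties are algebraic), which proves this instance outright.
[cite: BuchweitzFlenner2003, §5 Thm. 5.1] -/
theorem BuchweitzFlenner2003_variationalHodge_semiregular.ch_two_mem_algebraicClasses_self
    (C : ChernCharacterBetti) {𝒳 S : Motives.SchemeOver ℂ} (π : 𝒳 ⟶ S) (n : ℕ)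
    (hπ : Motives.IsSmoothProjectiveFamily π n) (s₀ : Motives.ComplexPoints S)
    (E₀ : (Motives.fiberOver π s₀).left.Modules) (hE₀ : Motives.IsFiniteLocallyFree E₀) :
    C.ch (Motives.fiberOver π s₀) E₀ 2 ∈ algebraicClasses (Motives.fiberOver π s₀) 2 :=
  C.ch_mem_algebraicClasses (hπ.isSmoothProjective s₀) E₀ hE₀.isVectorBundle 2

/-- **Perry 2026, Thm. 1.1 (2) (the Chern character of a semiregular sheaf remains algebraic along a
smooth proper family over a complex variety), case `B_0 = 0`, `E_0` a finite locally free
`{0,1}`-semiregular sheaf.** Printed: "Let `f : X → S` be a smooth proper family of complex varieties.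
Let `0 ∈ S(ℂ)` be a point and let `E_0 ∈ D_perf(X_0)` be a semiregular perfect complex with
`Ext^{<0}(E_0, E_0) = 0`. Assume that `B_0 ∈ H²(X_0, ℚ(1))` is an algebraic class such that
`w_0 = exp(B_0) · ch(E_0)` […] remains Hodge along `S`, i.e. lifts to a global section `w` of the local
system `⊕_{k ≥ 0} R^{2k}f_*ℚ(k)`. Then […] (2) The class `w_0` remains algebraic along `S`, i.e. for
every point `s ∈ S(ℂ)` the fiber `w_s` […] of `w` over `s` is algebraic" (with Thm. 6.1: "`S` is a
complex variety"). Rendering (module docstring): for every Chern character theory `C`, every smooth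
projective family `π : 𝒳 ⟶ S` of relative dimension `n` over a smooth, integral, quasi-projective
`ℂ`-scheme `S`, every family `w_k` (`k ≥ 0`) of CONTINUOUS sections `s ↦ (s, w_k(s))` of the étalé
spaces of `R^{2k}π_*ℂ` with values rational `(k,k)`-classes, every `s₀ ∈ S(ℂ)` and every finite locally
free `{0,1}`-semiregular `E_0` on `X_{s₀}` with `w_k(s₀) = ch_k(E_0)` for all `k`: `w_k(s)` is an
algebraic class of `X_s` for every `s ∈ S(ℂ)` and every `k`.
[claim: Perry2026Semiregularity, status: under-review] -/
def Perry2026_semiregular_remainsAlgebraic : Prop :=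
  ∀ (C : ChernCharacterBetti) ⦃𝒳 S : Motives.SchemeOver ℂ⦄ (π : 𝒳 ⟶ S) (n : ℕ),
    Motives.IsSmoothProjectiveFamily π n → IsQuasiProjectiveOver S → IsIntegral S.left →
    _root_.AlgebraicGeometry.Smooth S.hom →
    ∀ (w : ∀ (k : ℕ) (s : Motives.ComplexPoints S), complexBetti (Motives.fiberOver π s) (2 * k)),
      (∀ k, Continuous fun s => (⟨s, w k s⟩ : FiberClass π (2 * k))) →
      (∀ k s, (⟨s, w k s⟩ : FiberClass π (2 * k)) ∈ locusOfHodgeClasses π n k) →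
      ∀ (s₀ : Motives.ComplexPoints S) (E₀ : (Motives.fiberOver π s₀).left.Modules)
        (hE₀ : Motives.IsFiniteLocallyFree E₀), IsZeroOneSemiregular hE₀ →
        (∀ k, w k s₀ = C.ch (Motives.fiberOver π s₀) E₀ k) →
        ∀ (s : Motives.ComplexPoints S) (k : ℕ), w k s ∈ algebraicClasses (Motives.fiberOver π s) k

/-- **The degree-`2` instance of Perry's conclusion** (the form STUB 2 of `semiregular-twin-hecke-vhc`
and `TwinSpread` consume: the flat lift of `ch_2(E_0)` is algebraic on EVERY fibre).
[claim: Perry2026Semiregularity, status: under-review] -/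
theorem Perry2026_semiregular_remainsAlgebraic.two (hP : Perry2026_semiregular_remainsAlgebraic)
    (C : ChernCharacterBetti) {𝒳 S : Motives.SchemeOver ℂ} (π : 𝒳 ⟶ S) (n : ℕ)
    (hπ : Motives.IsSmoothProjectiveFamily π n) (hS : IsQuasiProjectiveOver S) (hSi : IsIntegral S.left)
    (hSs : _root_.AlgebraicGeometry.Smooth S.hom)
    (w : ∀ (k : ℕ) (s : Motives.ComplexPoints S), complexBetti (Motives.fiberOver π s) (2 * k))
    (hwc : ∀ k, Continuous fun s => (⟨s, w k s⟩ : FiberClass π (2 * k)))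
    (hwH : ∀ k s, (⟨s, w k s⟩ : FiberClass π (2 * k)) ∈ locusOfHodgeClasses π n k)
    (s₀ : Motives.ComplexPoints S) (E₀ : (Motives.fiberOver π s₀).left.Modules)
    (hE₀ : Motives.IsFiniteLocallyFree E₀) (hsr : IsZeroOneSemiregular hE₀)
    (hw₀ : ∀ k, w k s₀ = C.ch (Motives.fiberOver π s₀) E₀ k) (s : Motives.ComplexPoints S) :
    w 2 s ∈ algebraicClasses (Motives.fiberOver π s) 2 :=
  hP C π n hπ hS hSi hSs w hwc hwH s₀ E₀ hE₀ hsr hw₀ s 2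

/-! ### The last step of the printed proof of Thm. 5.1: classes of an extended bundle (proved)

BF, proof of Thm. 5.1 (p. 27 of the arXiv text): once a coherent `S`-flat `ℱ` on `X` inducing
`ℰ_0` on the special fibre has been found (Prop. 5.9 and Lemma 5.10 for the infinitesimal
liftings, a versal deformation and "Artin's approximation theorem" for convergence), "the uniqueness
of the horizontal lifting gives that `α_p = ch_p(ℱ)` as sections in `R^p f_*(Ω^p_{X/S})` for each
`p ∈ I`. Hence `α_p(s) = ch_p(ℱ|X_s)` is algebraic for all `s ∈ S` near `0` and each `p ∈ I`." On
the tree's carriers, for `ℱ` finite locally free on the total space `𝒳` of the algebraic family: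
the flat transport of `ch_p(ℱ|X_s)` along any path in `U` is `ch_p(ℱ|X_t)` — restrictions of the
global class `ch_p(ℱ)` are flat (`transportFun_map_fiberι`, the uniqueness of horizontal lifts) and
`ch_p` commutes with pull-back (`ChernCharacterBetti.map_ch`) — hence an algebraic class of the
smooth projective fibre `X_t` (`ChernCharacterBetti.ch_mem_algebraicClasses`). This proves the
conclusion of `BuchweitzFlenner2003_variationalHodge_semiregular` outright, with `W = U`, whenever
`ℰ_0` extends to a vector bundle on `𝒳`; the content of Thm. 5.1 — the EXISTENCE of an extension
near `s₀` from semiregularity and horizontality — is what these lemmas do not touch. -/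

/-- **Flat transport of the Chern character of a restricted bundle** ("the uniqueness of the
horizontal lifting gives that `α_p = ch_p(ℱ)` as sections"): for `ℱ` finite locally free on `𝒳`
and `E₀ ≅ ℱ|X_s`, the transport of `ch_p(E₀)` along every homotopy class of paths in a
cohomologically locally trivial `U` is `ch_p(ℱ|X_t)`.
[cite: BuchweitzFlenner2003, §5, proof of Thm. 5.1] -/
theorem transportFun_ch_eq_ch_pullback_of_iso (C : ChernCharacterBetti)
    {𝒳 S : Motives.SchemeOver ℂ} (π : 𝒳 ⟶ S) {U : Set (Motives.ComplexPoints S)}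
    (hU : IsCohomologicallyLocallyTrivialOn π U) (ℱ : 𝒳.left.Modules)
    (hℱ : Motives.IsFiniteLocallyFree ℱ) {s t : U} (γ : Path.Homotopic.Quotient s t)
    {E₀ : (Motives.fiberOver π s.1).left.Modules}
    (e : E₀ ≅ (Scheme.Modules.pullback (Motives.fiberι π s.1).left).obj ℱ) (p : ℕ) :
    transportFun π (2 * p) hU γ (C.ch (Motives.fiberOver π s.1) E₀ p) =
      C.ch (Motives.fiberOver π t.1)
        ((Scheme.Modules.pullback (Motives.fiberι π t.1).left).obj ℱ) p := by
  rw [C.ch_congr e, ← C.map_ch (Motives.fiberι π s.1) ℱ hℱ.isVectorBundle p,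
    transportFun_map_fiberι, C.map_ch (Motives.fiberι π t.1) ℱ hℱ.isVectorBundle p]

/-- **"Hence `α_p(s) = ch_p(ℱ|X_s)` is algebraic"**: in a smooth projective family, the transport
of `ch_p(E₀)`, `E₀ ≅ ℱ|X_s` for a finite locally free `ℱ` on `𝒳`, is an algebraic class on every
fibre reached by a path in `U` (pull-backs of finite locally free modules are finite locally free,
and Chern characters of vector bundles on smooth projective varieties are algebraic).
[cite: BuchweitzFlenner2003, §5, proof of Thm. 5.1] -/
theorem transportFun_ch_mem_algebraicClasses_of_iso (C : ChernCharacterBetti)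
    {𝒳 S : Motives.SchemeOver ℂ} (π : 𝒳 ⟶ S) {n : ℕ} (hπ : Motives.IsSmoothProjectiveFamily π n)
    {U : Set (Motives.ComplexPoints S)} (hU : IsCohomologicallyLocallyTrivialOn π U)
    (ℱ : 𝒳.left.Modules) (hℱ : Motives.IsFiniteLocallyFree ℱ) {s t : U}
    (γ : Path.Homotopic.Quotient s t) {E₀ : (Motives.fiberOver π s.1).left.Modules}
    (e : E₀ ≅ (Scheme.Modules.pullback (Motives.fiberι π s.1).left).obj ℱ) (p : ℕ) :
    transportFun π (2 * p) hU γ (C.ch (Motives.fiberOver π s.1) E₀ p) ∈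
      algebraicClasses (Motives.fiberOver π t.1) p := by
  rw [transportFun_ch_eq_ch_pullback_of_iso C π hU ℱ hℱ γ e p]
  exact C.ch_mem_algebraicClasses (hπ.isSmoothProjective t.1) _
    (hℱ.pullback (Motives.fiberι π t.1).left).isVectorBundle p

/-- **Thm. 5.1 (`I = {1, 2}`) in the extended case, proved.** If `ℰ_0 ≅ ℱ|X_{s₀}` for a finite
locally free `ℱ` on the total space `𝒳`, the conclusion of
`BuchweitzFlenner2003_variationalHodge_semiregular` holds with `W = U` (no semiregularity or Hodge
hypothesis is then needed: this is the final sentence of the printed proof; the theorem's content is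
the construction of such an `ℱ` near `s₀` from `I`-semiregularity and horizontality — Prop. 5.9,
Lemma 5.10, versality and Artin approximation — which is not formalised here).
[cite: BuchweitzFlenner2003, §5, proof of Thm. 5.1] -/
theorem BuchweitzFlenner2003_variationalHodge_semiregular.conclusion_of_iso_pullback
    (C : ChernCharacterBetti) {𝒳 S : Motives.SchemeOver ℂ} (π : 𝒳 ⟶ S) (n : ℕ)
    (hπ : Motives.IsSmoothProjectiveFamily π n) {U : Set (Motives.ComplexPoints S)}
    (hU : IsCohomologicallyLocallyTrivialOn π U) (s₀ : U)
    (E₀ : (Motives.fiberOver π s₀.1).left.Modules) (ℱ : 𝒳.left.Modules)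
    (hℱ : Motives.IsFiniteLocallyFree ℱ)
    (e : E₀ ≅ (Scheme.Modules.pullback (Motives.fiberι π s₀.1).left).obj ℱ) :
    ∃ (W : Set (Motives.ComplexPoints S)) (hWo : IsOpen W) (hW₀ : s₀.1 ∈ W) (hWU : W ⊆ U),
      ∀ (t : W) (γ : Path.Homotopic.Quotient (⟨s₀.1, hW₀⟩ : W) t),
        transportFun π (2 * 1) (hU.mono hWU hWo) γ (C.ch (Motives.fiberOver π s₀.1) E₀ 1) ∈
            algebraicClasses (Motives.fiberOver π t.1) 1 ∧
          transportFun π (2 * 2) (hU.mono hWU hWo) γ (C.ch (Motives.fiberOver π s₀.1) E₀ 2) ∈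
            algebraicClasses (Motives.fiberOver π t.1) 2 := by
  refine ⟨U, hU.isOpen, s₀.2, Set.Subset.rfl, fun t γ => ⟨?_, ?_⟩⟩
  · exact transportFun_ch_mem_algebraicClasses_of_iso C π hπ _ ℱ hℱ γ e 1
  · exact transportFun_ch_mem_algebraicClasses_of_iso C π hπ _ ℱ hℱ γ e 2

/-- **The `ch₁`-half carries no deformation-theoretic content**: granted the rational Lefschetz
theorem on `(1,1)`-classes (the tree's named fact `lefschetzOneOne_rational`, Voisin I Thm. 11.30
with §11.3.3: "the case `k = 1` of the Hodge conjecture holds") and rational descent over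
trivialising opens (the hypothesis of `isRationalClass_transportFun`, so that transports of the
rational class `ch₁(ℰ_0)` stay rational), the transport of `ch₁(ℰ_0)` is algebraic on EVERY fibre
reached in `U` as soon as it is of type `(1,1)` there — for any finite locally free `ℰ_0`,
semiregular or not. The content of Thm. 5.1 for `I = {1, 2}` is thus its `ch₂`-half.
[cite: VoisinHodgeI2002, Thm. 11.30 and §11.3.3] [cite: BuchweitzFlenner2003, §5 Thm. 5.1] -/
theorem BuchweitzFlenner2003_variationalHodge_semiregular.ch_one_of_lefschetzOneOne
    (hL : lefschetzOneOne_rational) (C : ChernCharacterBetti) {𝒳 S : Motives.SchemeOver ℂ}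
    (π : 𝒳 ⟶ S) {n : ℕ} (hπ : Motives.IsSmoothProjectiveFamily π n)
    {U : Set (Motives.ComplexPoints S)} (hU : IsCohomologicallyLocallyTrivialOn π U)
    (hrat : ∀ ⦃t : Motives.ComplexPoints S⦄, t ∈ U → ∃ B : Set (Motives.ComplexPoints S),
      IsOpen B ∧ t ∈ B ∧ B ⊆ U ∧
      (∀ (j : ℕ) ⦃s : Motives.ComplexPoints S⦄ (hs : s ∈ B), Function.Bijective (fiberRestrict π hs j)) ∧
      ∀ (j : ℕ) ⦃s : Motives.ComplexPoints S⦄ (hs : s ∈ B) (ξ : singularCohomology ℂ ℂ (tubeOver π B) j),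
        IsRationalClass (fiberRestrict π hs j ξ) → IsRationalClass ξ)
    (s₀ : U) (E₀ : (Motives.fiberOver π s₀.1).left.Modules) (hE₀ : Motives.IsFiniteLocallyFree E₀)
    (t : U) (γ : Path.Homotopic.Quotient s₀ t)
    (hHodge : IsOfHodgeType n (Motives.fiberOver π t.1) (2 * 1) 1 1
      (transportFun π (2 * 1) hU γ (C.ch (Motives.fiberOver π s₀.1) E₀ 1))) :
    transportFun π (2 * 1) hU γ (C.ch (Motives.fiberOver π s₀.1) E₀ 1) ∈
      algebraicClasses (Motives.fiberOver π t.1) 1 :=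
  hL (hπ.isSmoothProjective t.1) _
    (isRationalClass_transportFun π (2 * 1) hU hrat γ
      (C.isRationalClass_ch (Motives.fiberOver π s₀.1) E₀ hE₀.isVectorBundle 1)) hHodge

end HodgeTheory

end Literature.AlgebraicGeometry.HodgeTheory

end
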